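import Mathlib
import Summits.CriticalPhenomena.PercolationContinuityZ3.Theorems.PercNearOneGluingNoHeavyLowerTailOrientedAntipodalHallCoIntThreePetals

/-!
# Three petals: STRICT CYCLIC SURPLUS implies CoI-Kleitman (the reduction of the open class T6 to an 'existence of one more good' statement)

Helper file for crux `stmt-CriticalPhenomena-4575` (`NoHeavyLowerTail`, route `PercNearOneGluingNoHeavy`), hull-port seat `prim-hp-7`
(generation 56); `--supports stmt-CriticalPhenomena-4575`.  Everything here is PROVED; no definitions.

Setting of `…OrientedAntipodalHall*`: `f` monotone into `Lab k`, ground set `S`, a co-intersecting family `D` of antipodal bads with types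
`(i X, j X)` among three petals `p, q, r`.  After gen 54 the only open type class on three petals is T6 (all six types); every family
missing one ordered type is covered by `card_le_card_goods_above_of_coint_fiveTypes` (T5) with suitable parameters.

**Theorem (`card_le_card_goods_above_of_strictCyclic`).**  Fix `f`, `S`, the petals `p, q, r` and the type maps `i, j`.  Suppose
STRICT CYCLIC SURPLUS holds for this labelling: every co-intersecting family `D'` of such bads that contains a CYCLIC TRIPLE of types
`(u,v), (v,w), (w,u)` and satisfies Hall's counting condition on all its sub-families has at least `#D' + 1` goods above its members.
Then EVERY co-intersecting family `D` of such bads has at least `#D` goods above its members (and, `exists_injective_good_above_of_strictCyclic`,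
distinct good representatives).  Proof (memo `prim-hp-7/FROM-prim-hp-7-g56-STRICT-SURPLUS.md` §3): strong induction on `#D`; if some ordered
type `(x,y)` is absent, T5 with `(a,b,c) = (z,y,x)` applies; if all six types are present, remove one bad `X₀` of type `(p,q)`: the rest still
contains the cyclic triple `(q,p),(p,r),(r,q)`, satisfies Hall by induction, hence has `≥ #D` goods, all of them above members of `D`.
So the T6 case of CoI-Kleitman follows from 'no Hall-tight family contains a cyclic triangle' — verified exhaustively for all
co-intersecting sub-families of 2·10⁵ sparse labellings on 6 and 7 points (≈ 10⁹ sub-families, memo §4) and proved for one bad per type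
(memo §5).  (prim-hp-7 gen 56, 2026-08-22.)
-/

namespace Summit.CriticalPhenomena.PercolationContinuityZ3.Theorems

namespace OrientedAntipodalHall

open Finset AntipodalStrongHarris AntipodalStrongHarris.Lab
open scoped FinsetFamily

variable {α : Type*} [DecidableEq α] {k : ℕ}

omit [DecidableEq α] in
/-- Bookkeeping: if the types of `D` lie among three distinct petals `x, y, z`, are off-diagonal, and the ordered type `(x, y)`
does not occur, then `D` is in the T5 class with parameters `(a, b, c) = (z, y, x)`. -/
theorem fiveTypes_of_missing {D : Finset (Finset α)} {i j : Finset α → Fin k} {x y z : Fin k}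
    (hP : ∀ X ∈ D, (i X = x ∨ i X = y ∨ i X = z) ∧ (j X = x ∨ j X = y ∨ j X = z))
    (hij : ∀ X ∈ D, i X ≠ j X) (hmiss : ∀ X ∈ D, ¬ (i X = x ∧ j X = y)) :
    ∀ X ∈ D, (i X = z ∧ (j X = y ∨ j X = x)) ∨ (i X = y ∧ (j X = z ∨ j X = x)) ∨ (i X = x ∧ j X = z) := by
  intro X hX
  obtain ⟨hi, hj⟩ := hP X hX
  have h1 := hij X hX
  have h2 := hmiss X hX
  rcases hi with hi | hi | hi <;> rcases hj with hj | hj | hj <;> simp_all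

/-- **Strict cyclic surplus ⟹ the Hall count, three petals.**  See the module docstring.  `hstrict` is the strictness
hypothesis for THIS labelling: a co-intersecting family of bads (types among `p, q, r`) containing a cyclic triple of types and satisfying
Hall's counting condition on all sub-families has strictly more goods above it than members. -/
theorem card_le_card_goods_above_of_strictCyclic (S : Finset α) {f : Finset α → Lab k}
    (hf : ∀ ⦃X Y : Finset α⦄, X ⊆ Y → f X ≤ f Y) (i j : Finset α → Fin k)
    {p q r : Fin k} (hpq : p ≠ q) (hpr : p ≠ r) (hqr : q ≠ r)
    (hstrict : ∀ D' : Finset (Finset α), (∀ X ∈ D', X ⊆ S) → (∀ X ∈ D', f X = petal (i X)) →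
      (∀ X ∈ D', f (S \ X) = petal (j X)) →
      (∀ X ∈ D', (i X = p ∨ i X = q ∨ i X = r) ∧ (j X = p ∨ j X = q ∨ j X = r)) →
      (∀ X ∈ D', ∀ Y ∈ D', X ∪ Y ≠ S) →
      (∃ u v w : Fin k, (∃ X ∈ D', i X = u ∧ j X = v) ∧ (∃ Y ∈ D', i Y = v ∧ j Y = w) ∧ (∃ Z ∈ D', i Z = w ∧ j Z = u)) →
      (∀ D'' ⊆ D', #D'' ≤ #{U ∈ S.powerset | f U = top ∧ f (S \ U) = bot ∧ ∃ X ∈ D'', X ⊆ U}) →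
      #D' + 1 ≤ #{U ∈ S.powerset | f U = top ∧ f (S \ U) = bot ∧ ∃ X ∈ D', X ⊆ U})
    (D : Finset (Finset α)) (hDS : ∀ X ∈ D, X ⊆ S) (hDi : ∀ X ∈ D, f X = petal (i X))
    (hDj : ∀ X ∈ D, f (S \ X) = petal (j X)) (hij : ∀ X ∈ D, i X ≠ j X)
    (hP : ∀ X ∈ D, (i X = p ∨ i X = q ∨ i X = r) ∧ (j X = p ∨ j X = q ∨ j X = r))
    (hco : ∀ X ∈ D, ∀ Y ∈ D, X ∪ Y ≠ S) :
    #D ≤ #{U ∈ S.powerset | f U = top ∧ f (S \ U) = bot ∧ ∃ X ∈ D, X ⊆ U} := by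
  classical
  -- strong induction on the size of the family
  induction' hn : #D using Nat.strong_induction_on with n ih generalizing D
  subst hn
  -- Case 1: some ordered type `(x, y)` is absent: T5 with `(a, b, c) = (z, y, x)`.
  by_cases hall6 : (∃ X ∈ D, i X = p ∧ j X = q) ∧ (∃ X ∈ D, i X = q ∧ j X = p) ∧ (∃ X ∈ D, i X = p ∧ j X = r) ∧
      (∃ X ∈ D, i X = r ∧ j X = p) ∧ (∃ X ∈ D, i X = q ∧ j X = r) ∧ (∃ X ∈ D, i X = r ∧ j X = q)
  swap
  · -- extract a missing type
    have hT5 : ∀ {x y z : Fin k}, x ≠ y → x ≠ z → y ≠ z →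
        (∀ X ∈ D, (i X = x ∨ i X = y ∨ i X = z) ∧ (j X = x ∨ j X = y ∨ j X = z)) →
        (∀ X ∈ D, ¬ (i X = x ∧ j X = y)) →
        #D ≤ #{U ∈ S.powerset | f U = top ∧ f (S \ U) = bot ∧ ∃ X ∈ D, X ⊆ U} := by
      intro x y z hxy hxz hyz hP' hmiss
      exact card_le_card_goods_above_of_coint_fiveTypes S hf D i j hDS hDi hDj (a := z) (b := y) (c := x)
        hyz.symm hxz.symm hxy.symm (fiveTypes_of_missing hP' hij hmiss) hco
    have hPqpr : ∀ X ∈ D, (i X = q ∨ i X = p ∨ i X = r) ∧ (j X = q ∨ j X = p ∨ j X = r) := by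
      intro X hX; obtain ⟨hi, hj⟩ := hP X hX; constructor <;> tauto
    have hPprq : ∀ X ∈ D, (i X = p ∨ i X = r ∨ i X = q) ∧ (j X = p ∨ j X = r ∨ j X = q) := by
      intro X hX; obtain ⟨hi, hj⟩ := hP X hX; constructor <;> tauto
    have hPrpq : ∀ X ∈ D, (i X = r ∨ i X = p ∨ i X = q) ∧ (j X = r ∨ j X = p ∨ j X = q) := by
      intro X hX; obtain ⟨hi, hj⟩ := hP X hX; constructor <;> tauto
    have hPqrp : ∀ X ∈ D, (i X = q ∨ i X = r ∨ i X = p) ∧ (j X = q ∨ j X = r ∨ j X = p) := by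
      intro X hX; obtain ⟨hi, hj⟩ := hP X hX; constructor <;> tauto
    have hPrqp : ∀ X ∈ D, (i X = r ∨ i X = q ∨ i X = p) ∧ (j X = r ∨ j X = q ∨ j X = p) := by
      intro X hX; obtain ⟨hi, hj⟩ := hP X hX; constructor <;> tauto
    simp only [not_and_or] at hall6
    rcases hall6 with h | h | h | h | h | h
    · exact hT5 hpq hpr hqr hP (fun X hX hc => h ⟨X, hX, hc⟩)
    · exact hT5 hpq.symm hqr hpr hPqpr (fun X hX hc => h ⟨X, hX, hc⟩)
    · exact hT5 hpr hpq hqr.symm hPprq (fun X hX hc => h ⟨X, hX, hc⟩)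
    · exact hT5 hpr.symm hqr.symm hpq hPrpq (fun X hX hc => h ⟨X, hX, hc⟩)
    · exact hT5 hqr hpq.symm hpr.symm hPqrp (fun X hX hc => h ⟨X, hX, hc⟩)
    · exact hT5 hqr.symm hpr.symm hpq.symm hPrqp (fun X hX hc => h ⟨X, hX, hc⟩)
  -- Case 2: all six types present.  Remove one bad of type `(p, q)`; the rest contains the cyclic triple `(q,p), (p,r), (r,q)`.
  obtain ⟨⟨X₀, hX₀, hX₀i, hX₀j⟩, ⟨Xqp, hXqp, hqp1, hqp2⟩, ⟨Xpr, hXpr, hpr1, hpr2⟩, -, -, ⟨Xrq, hXrq, hrq1, hrq2⟩⟩ := hall6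
  set G : Finset (Finset α) := {U ∈ S.powerset | f U = top ∧ f (S \ U) = bot ∧ ∃ X ∈ D, X ⊆ U} with hG
  set D' : Finset (Finset α) := D.erase X₀ with hD'
  have hsub : D' ⊆ D := erase_subset X₀ D
  have hcard : #D' + 1 = #D := card_erase_add_one hX₀
  have hXqp' : Xqp ∈ D' := by
    refine mem_erase.mpr ⟨fun h => hpq ?_, hXqp⟩
    rw [← hX₀i, ← h, hqp1]
  have hXpr' : Xpr ∈ D' := by
    refine mem_erase.mpr ⟨fun h => hqr ?_, hXpr⟩
    rw [← hX₀j, ← h, hpr2]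
  have hXrq' : Xrq ∈ D' := by
    refine mem_erase.mpr ⟨fun h => hpr ?_, hXrq⟩
    rw [← hX₀i, ← h, hrq1]
  -- Hall's counting condition for every sub-family of `D'`, by induction
  have hHall : ∀ D'' ⊆ D', #D'' ≤ #{U ∈ S.powerset | f U = top ∧ f (S \ U) = bot ∧ ∃ X ∈ D'', X ⊆ U} := by
    intro D'' hD''
    have hD''D : D'' ⊆ D := hD''.trans hsub
    have hlt : #D'' < #D := by
      have := card_le_card hD''
      omega
    exact ih (#D'') hlt D'' (fun X hX => hDS X (hD''D hX)) (fun X hX => hDi X (hD''D hX))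
      (fun X hX => hDj X (hD''D hX)) (fun X hX => hij X (hD''D hX)) (fun X hX => hP X (hD''D hX))
      (fun X hX Y hY => hco X (hD''D hX) Y (hD''D hY)) rfl
  have hstrictD' := hstrict D' (fun X hX => hDS X (hsub hX)) (fun X hX => hDi X (hsub hX))
    (fun X hX => hDj X (hsub hX)) (fun X hX => hP X (hsub hX)) (fun X hX Y hY => hco X (hsub hX) Y (hsub hY))
    ⟨q, p, r, ⟨Xqp, hXqp', hqp1, hqp2⟩, ⟨Xpr, hXpr', hpr1, hpr2⟩, ⟨Xrq, hXrq', hrq1, hrq2⟩⟩ hHall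
  -- the goods above `D'` are goods above `D`
  have hmono : {U ∈ S.powerset | f U = top ∧ f (S \ U) = bot ∧ ∃ X ∈ D', X ⊆ U} ⊆ G := by
    intro U hU
    rw [mem_filter] at hU ⊢
    obtain ⟨hUS, hUt, hUb, X, hX, hXU⟩ := hU
    exact ⟨hUS, hUt, hUb, X, hsub hX, hXU⟩
  have := card_le_card hmono
  omega

/-- **Strict cyclic surplus ⟹ CoI-Kleitman (SDR form), three petals.**  Under the strictness hypothesis of
`card_le_card_goods_above_of_strictCyclic`, every co-intersecting family of bads with types among `p, q, r` has DISTINCT good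
representatives: an injective `φ` on `D` with `X ⊆ φ X ⊆ S`, `f (φ X) = A`, `f (S \ φ X) = B`. -/
theorem exists_injective_good_above_of_strictCyclic (S : Finset α) {f : Finset α → Lab k}
    (hf : ∀ ⦃X Y : Finset α⦄, X ⊆ Y → f X ≤ f Y) (i j : Finset α → Fin k)
    {p q r : Fin k} (hpq : p ≠ q) (hpr : p ≠ r) (hqr : q ≠ r)
    (hstrict : ∀ D' : Finset (Finset α), (∀ X ∈ D', X ⊆ S) → (∀ X ∈ D', f X = petal (i X)) →
      (∀ X ∈ D', f (S \ X) = petal (j X)) →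
      (∀ X ∈ D', (i X = p ∨ i X = q ∨ i X = r) ∧ (j X = p ∨ j X = q ∨ j X = r)) →
      (∀ X ∈ D', ∀ Y ∈ D', X ∪ Y ≠ S) →
      (∃ u v w : Fin k, (∃ X ∈ D', i X = u ∧ j X = v) ∧ (∃ Y ∈ D', i Y = v ∧ j Y = w) ∧ (∃ Z ∈ D', i Z = w ∧ j Z = u)) →
      (∀ D'' ⊆ D', #D'' ≤ #{U ∈ S.powerset | f U = top ∧ f (S \ U) = bot ∧ ∃ X ∈ D'', X ⊆ U}) →
      #D' + 1 ≤ #{U ∈ S.powerset | f U = top ∧ f (S \ U) = bot ∧ ∃ X ∈ D', X ⊆ U})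
    (D : Finset (Finset α)) (hDS : ∀ X ∈ D, X ⊆ S) (hDi : ∀ X ∈ D, f X = petal (i X))
    (hDj : ∀ X ∈ D, f (S \ X) = petal (j X)) (hij : ∀ X ∈ D, i X ≠ j X)
    (hP : ∀ X ∈ D, (i X = p ∨ i X = q ∨ i X = r) ∧ (j X = p ∨ j X = q ∨ j X = r))
    (hco : ∀ X ∈ D, ∀ Y ∈ D, X ∪ Y ≠ S) :
    ∃ φ : D → Finset α, Function.Injective φ ∧
      ∀ X : D, (X : Finset α) ⊆ φ X ∧ φ X ⊆ S ∧ f (φ X) = top ∧ f (S \ φ X) = bot := by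
  classical
  let t : D → Finset (Finset α) := fun X =>
    {U ∈ S.powerset | f U = top ∧ f (S \ U) = bot ∧ (X : Finset α) ⊆ U}
  have hHall : ∀ s : Finset D, #s ≤ #(s.biUnion t) := by
    intro s
    set D' : Finset (Finset α) := s.map (Function.Embedding.subtype _) with hD'
    have hD'sub : ∀ X ∈ D', X ∈ D := by
      intro X hX
      obtain ⟨x, -, rfl⟩ := mem_map.mp hX
      exact x.2
    have hcard : #s = #D' := (card_map _).symm
    have hle := card_le_card_goods_above_of_strictCyclic S hf i j hpq hpr hqr hstrict D'
      (fun X hX => hDS X (hD'sub X hX)) (fun X hX => hDi X (hD'sub X hX)) (fun X hX => hDj X (hD'sub X hX))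
      (fun X hX => hij X (hD'sub X hX)) (fun X hX => hP X (hD'sub X hX))
      (fun X hX Y hY => hco X (hD'sub X hX) Y (hD'sub Y hY))
    have hgoods : {U ∈ S.powerset | f U = top ∧ f (S \ U) = bot ∧ ∃ X ∈ D', X ⊆ U} ⊆ s.biUnion t := by
      intro U hU
      rw [mem_filter, mem_powerset] at hU
      obtain ⟨hUS, hUtop, hUbot, X, hX, hXU⟩ := hU
      obtain ⟨x, hx, rfl⟩ := mem_map.mp hX
      rw [mem_biUnion]
      refine ⟨x, hx, ?_⟩
      simp only [t, mem_filter, mem_powerset]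
      exact ⟨hUS, hUtop, hUbot, hXU⟩
    calc #s = #D' := hcard
      _ ≤ #{U ∈ S.powerset | f U = top ∧ f (S \ U) = bot ∧ ∃ X ∈ D', X ⊆ U} := hle
      _ ≤ #(s.biUnion t) := card_le_card hgoods
  obtain ⟨φ, hφinj, hφ⟩ := (all_card_le_biUnion_card_iff_exists_injective t).mp hHall
  refine ⟨φ, hφinj, fun X => ?_⟩
  have hX := hφ X
  simp only [t, mem_filter, mem_powerset] at hX
  exact ⟨hX.2.2.2, hX.1, hX.2.1, hX.2.2.1⟩

end OrientedAntipodalHall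

end Summit.CriticalPhenomena.PercolationContinuityZ3.Theorems
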